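import Literature.Analysis.ValidatedNumerics.TaylorModelContract
import Literature.Analysis.ValidatedNumerics.TaylorModelExp
import HarnessLib

/-!
# The symmetric second difference of a local Taylor expansion against kernel moments

Trunk T-ANA (Analysis/ValidatedNumerics); namespace `Literature.Analysis.ValidatedNumerics.PolyMP`.  Sequel of
`TaylorModelContract.lean`.  For a function `g` with an EXACT local expansion `g(y₀ + s) = Σ_r a_r s^r` (fixed reals
`a_r ∈ A_r`, an exact-degree interval coefficient list, e.g. `shiftI` of a polynomial) and a kernel `G` on `[0, 2h]` with
certified moments `M_j ∋ ∫_0^{2h} G(t) t^j dt`, the singular-looking panel integral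

  `ρ ↦ ∫_0^{2h} G(t) · (2g(y₀+ρ) − g(y₀+ρ−t) − g(y₀+ρ+t))/t dt`

is an exact polynomial in `ρ` with coefficients `−Σ_{b even ≥ 2} 2 C(p+b, p) a_{p+b} M_{b−1}` (the constant and odd
orders of the second difference cancel identically, so no `1/t` singularity survives): `panel0I`, `tmem_panel0`.  Integer
interval arithmetic only.  Problem-independent; no facts, no axioms.

## References

* K. Makino, M. Berz, Int. J. Pure Appl. Math. 4 (2003) 379–456, §6. [folklore]
-/

open MeasureTheory intervalIntegral Set Finset

namespace Literature.Analysis.ValidatedNumerics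

namespace PolyMP

open Literature.Analysis.ValidatedNumerics.NumericsMP

/-- Coefficient `p`: `−Σ_{b even, 2 ≤ b < |A| − p} 2 C(p+b, p) A_{p+b} M_{b−1}`. [folklore] -/
def panel0I (S : ℕ) (A : IPoly) (M : List MI) : IPoly :=
  (List.range A.length).map fun p =>
    (List.range (A.length - p)).foldl
      (fun acc b => MI.add acc (if b = 0 ∨ b % 2 = 1 then MI.ofScaled 0 else
        MI.neg (MI.mul S (MI.mulInt (A.getD (p + b) default) (2 * ((p + b).choose p : ℕ))) (M.getD (b - 1) default))))
      (MI.ofScaled 0)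

/-- The second-difference weight of order `b`, divided by `t`: `(2·0^b − (−t)^b − t^b)/t`. [folklore] -/
theorem symmDiff_weight (b : ℕ) (t : ℝ) :
    (2 * (0 : ℝ) ^ b - (-t) ^ b - t ^ b) / t = if b = 0 ∨ b % 2 = 1 then 0 else -2 * t ^ (b - 1) := by
  rcases Nat.eq_zero_or_pos b with rfl | hb
  · norm_num
  · have h0 : (0 : ℝ) ^ b = 0 := zero_pow hb.ne'
    rcases Nat.even_or_odd b with he | ho
    · have hne : ¬(b = 0 ∨ b % 2 = 1) := by
        rintro (h | h)
        · omega
        · exact Nat.not_even_iff_odd.2 (Nat.odd_iff.2 h) he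
      rw [if_neg hne, h0, he.neg_pow]
      rcases eq_or_ne t 0 with rfl | ht
      · have : b - 1 ≠ 0 := by
          intro h1
          have : b = 1 := by omega
          subst this
          exact (Nat.not_even_one he).elim
        simp [zero_pow hb.ne', zero_pow this]
      · obtain ⟨k, rfl⟩ : ∃ k, b = k + 1 := ⟨b - 1, by omega⟩
        simp only [Nat.add_sub_cancel, pow_succ]
        field_simp
        ring
    · have hyes : b = 0 ∨ b % 2 = 1 := Or.inr (Nat.odd_iff.1 ho)
      rw [if_pos hyes, h0, ho.neg_pow]
      ring

section Panel0

variable {S : ℕ} {h : ℚ} {G g : ℝ → ℝ} {y0 : ℝ}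

/-- **The panel-0 arch integral as an exact Taylor polynomial.**  `G` interval integrable on `[0, 2h]`, `M_j ∋ ∫_0^{2h} G t^j`
for `j + 1 < |A|`, and `g(y₀ + s) = Σ a_r s^r` with `a ∈ A`: then for EVERY `ρ` (any radius `R`),
`∫_0^{2h} G(t)(2g(y₀+ρ) − g(y₀+ρ−t) − g(y₀+ρ+t))/t dt ∈ panel0I S A M` at `ρ`. [folklore] -/
theorem tmem_panel0 (hS : 0 < S) (R : ℚ) (hG : IntervalIntegrable G volume 0 (2 * (h : ℝ))) {as : List ℝ}
    {A : IPoly} (has : PMem S as A) (hg : ∀ s, g (y0 + s) = evalR as s) {M : List MI}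
    (hM : ∀ j, j + 1 < A.length → MI.mem S (∫ t in (0 : ℝ)..(2 * (h : ℝ)), G t * t ^ j) (M.getD j default)) :
    TMem S R (fun ρ => ∫ t in (0 : ℝ)..(2 * (h : ℝ)),
      G t * ((2 * g (y0 + ρ) - g (y0 + ρ - t) - g (y0 + ρ + t)) / t)) (panel0I S A M) := by
  intro ρ _
  set n := A.length with hn
  have hlen : as.length = n := has.length_eq
  set m : ℕ → ℝ := fun j => ∫ t in (0 : ℝ)..(2 * (h : ℝ)), G t * t ^ j with hm
  -- the real coefficients
  set w : ℕ → ℕ → ℝ := fun p b => if b = 0 ∨ b % 2 = 1 then 0 else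
    -(as.getD (p + b) 0 * (2 * ((p + b).choose p : ℝ)) * m (b - 1)) with hw
  set cs : List ℝ := (List.range n).map fun p => ∑ b ∈ range (n - p), w p b with hcs
  refine ⟨cs, ?_, ?_⟩
  · -- membership
    rw [hcs, hn]
    unfold panel0I
    have key : ∀ p, p < A.length → MI.mem S (∑ b ∈ range (A.length - p), w p b)
        ((List.range (A.length - p)).foldl
          (fun acc b => MI.add acc (if b = 0 ∨ b % 2 = 1 then MI.ofScaled 0 else
            MI.neg (MI.mul S (MI.mulInt (A.getD (p + b) default) (2 * ((p + b).choose p : ℕ)))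
              (M.getD (b - 1) default)))) (MI.ofScaled 0)) := by
      intro p hp
      refine mem_foldl_add _ fun b hb => ?_
      simp only [hw]
      split_ifs with hc
      · exact mem_zero_ofScaled S
      · have hb2 : 2 ≤ b := by omega
        have h1 := MI.mem_mulInt (mem_getD_of_pmem has (i := p + b) (by omega)) (2 * ((p + b).choose p : ℕ))
        have h2 := MI.mem_mul hS h1 (hM (b - 1) (by omega))
        have h3 := MI.mem_neg h2
        push_cast at h3
        convert h3 using 1
    have : ∀ l : List ℕ, (∀ p ∈ l, p < A.length) →
        PMem S (l.map fun p => ∑ b ∈ range (A.length - p), w p b)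
          (l.map fun p => (List.range (A.length - p)).foldl
            (fun acc b => MI.add acc (if b = 0 ∨ b % 2 = 1 then MI.ofScaled 0 else
              MI.neg (MI.mul S (MI.mulInt (A.getD (p + b) default) (2 * ((p + b).choose p : ℕ)))
                (M.getD (b - 1) default)))) (MI.ofScaled 0)) := by
      intro l hl
      induction l with
      | nil => exact pmem_nil S
      | cons p l ih =>
          simp only [List.map_cons]
          exact pmem_cons (key p (hl p (by simp))) (ih fun x hx => hl x (by simp [hx]))
    exact this _ fun p hp => List.mem_range.1 hp
  · -- the value
    set Wt : ℕ → ℝ → ℝ := fun b t => if b = 0 ∨ b % 2 = 1 then 0 else -2 * t ^ (b - 1) with hWt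
    have hWc : ∀ b, Continuous (Wt b) := by
      intro b
      by_cases hc : b = 0 ∨ b % 2 = 1
      · have : Wt b = fun _ => 0 := by funext t; simp [hWt, hc]
        rw [this]; exact continuous_const
      · have : Wt b = fun t => -2 * t ^ (b - 1) := by funext t; simp [hWt, hc]
        rw [this]; exact continuous_const.mul (continuous_pow _)
    have eE : ∀ t : ℝ, 2 * evalR as (ρ + 0) - evalR as (ρ + -t) - evalR as (ρ + t) =
        ∑ p ∈ range n, ∑ b ∈ range (n - p),
          ρ ^ p * (as.getD (p + b) 0 * ((p + b).choose p : ℝ)) * (2 * (0 : ℝ) ^ b - (-t) ^ b - t ^ b) := by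
      intro t
      rw [evalR_add_eq_sum, evalR_add_eq_sum, evalR_add_eq_sum, hlen]
      simp only [Finset.mul_sum, ← Finset.sum_sub_distrib]
      refine Finset.sum_congr rfl fun p _ => Finset.sum_congr rfl fun b _ => ?_
      ring
    have epoint : ∀ t : ℝ, G t * ((2 * g (y0 + ρ) - g (y0 + ρ - t) - g (y0 + ρ + t)) / t) =
        ∑ p ∈ range n, ∑ b ∈ range (n - p),
          (ρ ^ p * (as.getD (p + b) 0 * ((p + b).choose p : ℝ))) * (G t * Wt b t) := by
      intro t
      have e0 : g (y0 + ρ) = evalR as (ρ + 0) := by rw [add_zero, hg]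
      have em : g (y0 + ρ - t) = evalR as (ρ + -t) := by rw [show y0 + ρ - t = y0 + (ρ + -t) by ring, hg]
      have ep : g (y0 + ρ + t) = evalR as (ρ + t) := by rw [add_assoc, hg]
      rw [e0, em, ep, eE t, Finset.sum_div, Finset.mul_sum]
      refine Finset.sum_congr rfl fun p _ => ?_
      rw [Finset.sum_div, Finset.mul_sum]
      refine Finset.sum_congr rfl fun b _ => ?_
      simp only [hWt]
      rw [← symmDiff_weight b t]
      ring
    beta_reduce
    rw [intervalIntegral.integral_congr fun t _ => epoint t]
    have hint : ∀ b, IntervalIntegrable (fun t => G t * Wt b t) volume 0 (2 * (h : ℝ)) := fun b =>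
      hG.mul_continuousOn (hWc b).continuousOn
    have step1 := intervalIntegral.integral_finsetSum (μ := volume) (a := (0 : ℝ)) (b := 2 * (h : ℝ))
      (s := range n) (f := fun p t => ∑ b ∈ range (n - p),
        (ρ ^ p * (as.getD (p + b) 0 * ((p + b).choose p : ℝ))) * (G t * Wt b t))
      fun p _ => by
        have : (fun t => ∑ b ∈ range (n - p), (ρ ^ p * (as.getD (p + b) 0 * ((p + b).choose p : ℝ))) *
            (G t * Wt b t)) = ∑ b ∈ range (n - p), fun t =>
              (ρ ^ p * (as.getD (p + b) 0 * ((p + b).choose p : ℝ))) * (G t * Wt b t) := by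
          funext t; simp only [Finset.sum_apply]
        rw [this]
        exact IntervalIntegrable.sum (range (n - p)) fun b _ => (hint b).const_mul _
    refine step1.trans ?_
    rw [hcs, evalR_map_range]
    refine Finset.sum_congr rfl fun p _ => ?_
    rw [intervalIntegral.integral_finsetSum fun b _ => (hint b).const_mul _, Finset.sum_mul]
    refine Finset.sum_congr rfl fun b _ => ?_
    rw [intervalIntegral.integral_const_mul]
    simp only [hw, hWt]
    by_cases hc : b = 0 ∨ b % 2 = 1
    · simp [hc]
    · simp only [hc, if_false]
      rw [show (fun t => G t * (-2 * t ^ (b - 1))) = fun t => (-2) * (G t * t ^ (b - 1)) by funext t; ring,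
        intervalIntegral.integral_const_mul]
      simp only [hm]
      ring

end Panel0


/-! ## The divided differences as polynomials in `t` (exported pointwise forms) -/

section Pointwise

variable {g : ℝ → ℝ} {y0 : ℝ} {as : List ℝ}

/-- `(2g(y₀+ρ) − g(y₀+ρ−t) − g(y₀+ρ+t))/t` is a polynomial in `t` (no singularity at `t = 0`). [folklore] -/
theorem symmDiff_div_eq_sum (hg : ∀ s, g (y0 + s) = evalR as s) (ρ t : ℝ) :
    (2 * g (y0 + ρ) - g (y0 + ρ - t) - g (y0 + ρ + t)) / t =
      ∑ p ∈ range as.length, ∑ b ∈ range (as.length - p),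
        ρ ^ p * (as.getD (p + b) 0 * ((p + b).choose p : ℝ)) * (if b = 0 ∨ b % 2 = 1 then 0 else -2 * t ^ (b - 1)) := by
  have e0 : g (y0 + ρ) = evalR as (ρ + 0) := by rw [add_zero, hg]
  have em : g (y0 + ρ - t) = evalR as (ρ + -t) := by rw [show y0 + ρ - t = y0 + (ρ + -t) by ring, hg]
  have ep : g (y0 + ρ + t) = evalR as (ρ + t) := by rw [add_assoc, hg]
  have eE : 2 * evalR as (ρ + 0) - evalR as (ρ + -t) - evalR as (ρ + t) =
      ∑ p ∈ range as.length, ∑ b ∈ range (as.length - p),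
        ρ ^ p * (as.getD (p + b) 0 * ((p + b).choose p : ℝ)) * (2 * (0 : ℝ) ^ b - (-t) ^ b - t ^ b) := by
    rw [evalR_add_eq_sum, evalR_add_eq_sum, evalR_add_eq_sum]
    simp only [Finset.mul_sum, ← Finset.sum_sub_distrib]
    refine Finset.sum_congr rfl fun p _ => Finset.sum_congr rfl fun b _ => ?_
    ring
  rw [e0, em, ep, eE, Finset.sum_div]
  refine Finset.sum_congr rfl fun p _ => ?_
  rw [Finset.sum_div]
  refine Finset.sum_congr rfl fun b _ => ?_
  rw [← symmDiff_weight b t]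
  ring

/-- Hence `t ↦ (2g(y₀+ρ) − g(y₀+ρ−t) − g(y₀+ρ+t))/t` is continuous. [folklore] -/
theorem continuous_symmDiff_div (hg : ∀ s, g (y0 + s) = evalR as s) (ρ : ℝ) :
    Continuous fun t : ℝ => (2 * g (y0 + ρ) - g (y0 + ρ - t) - g (y0 + ρ + t)) / t := by
  have : (fun t : ℝ => (2 * g (y0 + ρ) - g (y0 + ρ - t) - g (y0 + ρ + t)) / t) = fun t =>
      ∑ p ∈ range as.length, ∑ b ∈ range (as.length - p),
        ρ ^ p * (as.getD (p + b) 0 * ((p + b).choose p : ℝ)) * (if b = 0 ∨ b % 2 = 1 then 0 else -2 * t ^ (b - 1)) :=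
    funext fun t => symmDiff_div_eq_sum hg ρ t
  rw [this]
  refine continuous_finsetSum _ fun p _ => continuous_finsetSum _ fun b _ => ?_
  by_cases hc : b = 0 ∨ b % 2 = 1
  · simp only [hc, if_true, mul_zero]; exact continuous_const
  · simp only [hc, if_false]; exact continuous_const.mul (continuous_const.mul (continuous_pow _))

/-- The first-difference weight divided by `t ≠ 0`: `(0^b − (−t)^b)/t`. [folklore] -/
theorem firstDiff_weight (b : ℕ) {t : ℝ} (ht : t ≠ 0) :
    ((0 : ℝ) ^ b - (-t) ^ b) / t = if b = 0 then 0 else (-1) ^ (b + 1) * t ^ (b - 1) := by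
  rcases Nat.eq_zero_or_pos b with rfl | hb
  · norm_num
  · rw [if_neg hb.ne', zero_pow hb.ne']
    obtain ⟨k, rfl⟩ : ∃ k, b = k + 1 := ⟨b - 1, by omega⟩
    simp only [Nat.add_sub_cancel]
    rw [neg_pow, pow_succ, pow_succ]
    field_simp
    ring

/-- `(g(y₀+ρ) − g(y₀+ρ−t))/t` is a polynomial in `t` away from `t = 0` (at `t = 0` the Lean value is `0`). [folklore] -/
theorem firstDiff_div_eq_sum (hg : ∀ s, g (y0 + s) = evalR as s) (ρ : ℝ) {t : ℝ} (ht : t ≠ 0) :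
    (g (y0 + ρ) - g (y0 + ρ - t)) / t =
      ∑ p ∈ range as.length, ∑ b ∈ range (as.length - p),
        ρ ^ p * (as.getD (p + b) 0 * ((p + b).choose p : ℝ)) * (if b = 0 then 0 else (-1) ^ (b + 1) * t ^ (b - 1)) := by
  have e0 : g (y0 + ρ) = evalR as (ρ + 0) := by rw [add_zero, hg]
  have em : g (y0 + ρ - t) = evalR as (ρ + -t) := by rw [show y0 + ρ - t = y0 + (ρ + -t) by ring, hg]
  have eE : evalR as (ρ + 0) - evalR as (ρ + -t) =
      ∑ p ∈ range as.length, ∑ b ∈ range (as.length - p),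
        ρ ^ p * (as.getD (p + b) 0 * ((p + b).choose p : ℝ)) * ((0 : ℝ) ^ b - (-t) ^ b) := by
    rw [evalR_add_eq_sum, evalR_add_eq_sum, ← Finset.sum_sub_distrib]
    refine Finset.sum_congr rfl fun p _ => ?_
    rw [Finset.mul_sum, Finset.mul_sum, ← Finset.sum_sub_distrib]
    refine Finset.sum_congr rfl fun b _ => ?_
    ring
  rw [e0, em, eE, Finset.sum_div]
  refine Finset.sum_congr rfl fun p _ => ?_
  rw [Finset.sum_div]
  refine Finset.sum_congr rfl fun b _ => ?_
  rw [← firstDiff_weight b ht]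
  ring

/-- Hence `t ↦ (g(y₀+ρ) − g(y₀+ρ−t))/t` is continuous on `(0, ∞)`. [folklore] -/
theorem continuousOn_firstDiff_div (hg : ∀ s, g (y0 + s) = evalR as s) (ρ : ℝ) :
    ContinuousOn (fun t : ℝ => (g (y0 + ρ) - g (y0 + ρ - t)) / t) (Set.Ioi 0) := by
  have hpoly : Continuous fun t : ℝ =>
      ∑ p ∈ range as.length, ∑ b ∈ range (as.length - p),
        ρ ^ p * (as.getD (p + b) 0 * ((p + b).choose p : ℝ)) * (if b = 0 then 0 else (-1) ^ (b + 1) * t ^ (b - 1)) := by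
    refine continuous_finsetSum _ fun p _ => continuous_finsetSum _ fun b _ => ?_
    by_cases hc : b = 0
    · simp only [hc, if_true, mul_zero]; exact continuous_const
    · simp only [hc, if_false]; exact continuous_const.mul (continuous_const.mul (continuous_pow _))
  refine hpoly.continuousOn.congr fun t ht => ?_
  exact firstDiff_div_eq_sum hg ρ (ne_of_gt ht)

end Pointwise


end PolyMP

end Literature.Analysis.ValidatedNumerics
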